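import Summits.BirchSwinnertonDyer.BirchSwinnertonDyer.Theorems.EisensteinPrimesTwoVariableSelmerControl
import Literature.NumberTheory.EllipticCurves.Agboola2007.RestrictedSelmerGroups
import HarnessLib

/-!
# M-LINE-PIN, (C2a): the image of slot-1 control is cut out by ONE local condition — at `𝔮` (= `v̄`) — when the partner line is
# unramified outside `𝔮`; every other Selmer condition transfers along the tower automatically

Cell `bsd-print-cf2`, width seat `bsd-line-cf2c-w8` g3 (prover-bsd-line-cf2c-w8-g3-0), planner g19's named piece M-LINE-PIN, step (C2a) of
the memo `Cruxes/TwoVariableMainConjAtSplitTwo/M-LINE-PIN-cf2c-w8g3.md` §2 (sequel of (C1) p695906 `…LinePinSlotOneControl`).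
`--supports stmt-BirchSwinnertonDyer-24086 --as helper`, Theses-free. HONEST FRAMING: generic Galois-cohomological bookkeeping (every
number field `K`, prime `p`, Greenberg–Vatsal datum `L`, discrete `M`); it LOCATES the defect of M-LINE-PIN's `v`-line control at the
single place `𝔮 = v̄` but does not COMPUTE it ((C2b): `≅ ⊕_{w∣v̄} ℚ_p/ℤ_p(θ)` up to finite, not here); no summit statement is proved by
this seat; BSD is not proved by any of this. THEOREMS ONLY (no definition, no named fact, no `sorry`).

* §1 `mem_datumSelmer_of_resOfLe_mem_of_at` — the bsd-eis transfer lemma `IwasawaTwoVariable.mem_datumSelmer_of_resOfLe_mem` («if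
  `H ⊓ I_v ≤ S` at EVERY `v`, a class over `K̄^H` whose restriction to `K̄^S` satisfies the datum conditions satisfies them over `K̄^H`»)
  with ONE EXCEPTIONAL PLACE `𝔮 ∣ p`: the inertia hypothesis is asked only at `v ≠ 𝔮`, and at `𝔮` the Greenberg condition on the class
  itself is an explicit input.
* §2 over the `ℤ_p²`-tower with the PARTNER `κ₂` unramified outside `𝔮` (`κ₂.IsUnramifiedOutside 𝔮`, e.g. M-LINE-PIN: `κ = κ₁` the
  `v`-line, `κ₂` the `v̄`-line, `𝔮 = v̄`): `ker κ ⊓ I_w ≤ pairKer κ κ₂` at every `w ≠ 𝔮` (`kerSubgroup_inf_inertia_le_pairKer_of_ne`), hence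
  **`mem_range_lineRes_unr_iff_exists_lift`**: a class `s ∈ H¹_nr(K̃_∞, M)` is in the image of the slot-1 control map
  `g : H¹_nr(K_∞, M) → H¹_nr(K̃_∞, M)` of (C1) IFF it has a lift `y ∈ H¹(K_∞, M)` (`res y = s`) satisfying the Greenberg condition of the
  datum AT `𝔮` ALONE (all conjugates) — the conditions away from `𝔮` come for free from those of `s`. So the cokernel of control onto the
  `γ₂`-invariants (whose members all lift to `H¹(K_∞, M)`: `H²(ℤ_p, ·) = 0`, the tower lift of cf2c-w8 g0 p683924) is EXACTLY the failure
  of the `𝔮`-condition on lifts: the `v̄`-defect of the memo, and nothing else.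
presearch: Greenberg–Vatsal 2000 §2 pp. 17–21, Greenberg LNM 1716 §3 (tree theorems); assembly, no new fact. beyond-print theorem: no.

References: [GreenbergVatsal2000] §2 pp. 17–21; [GreenbergLNM1716] §3 Lemmas 3.1–3.2; [Washington1997] Prop. 13.2; [Agboola2007] §1 p. 1.
-/

-- the summit namespace `Summit.BirchSwinnertonDyer.BirchSwinnertonDyer` repeats the problem name by design (D-0017)
set_option linter.dupNamespace false
set_option autoImplicit false

noncomputable section

open scoped Classical

open NumberField IsDedekindDomain Field Literature.NumberTheory.GaloisRepresentations
  Literature.NumberTheory.EllipticCurves Literature.NumberTheory.EllipticCurves.GreenbergVatsal2000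
  Literature.NumberTheory.EllipticCurves.KellerYin2024 Literature.NumberTheory.EllipticCurves.GreenbergSelmer
  Literature.NumberTheory.EllipticCurves.Agboola2007
  Summit.BirchSwinnertonDyer.BirchSwinnertonDyer.Theorems.IwasawaTwoVariable

namespace Summit.BirchSwinnertonDyer.BirchSwinnertonDyer.Theorems.PrintCf2.LinePinControl

universe u

/-! ## §1 Transfer of the datum conditions along `K̄^S / K̄^H` with one exceptional place -/

section Generic

variable {K : Type u} [Field K] [NumberField K] {p : ℕ} [Fact p.Prime]
  {M : Type u} [AddCommGroup M] [DistribMulAction (absoluteGaloisGroup K) M] [TopologicalSpace M] [DiscreteTopology M]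
  {H S : Subgroup (absoluteGaloisGroup K)} [H.Normal] [S.Normal] (L : Data K M p) (S₀ : Set (HeightOneSpectrum (𝓞 K)))

omit [Fact p.Prime] in
/-- **Transfer with one exceptional place.** `S ≤ H`, `H ⊓ I_v ≤ S` at every `v ≠ 𝔮` (`𝔮 ∣ p`); a class `c ∈ H¹(K̄^H, M)` whose restriction to
`K̄^S` lies in `S^{S₀}_M(K̄^S)` and which ITSELF satisfies the Greenberg condition of the datum at `𝔮` (all conjugates) lies in `S^{S₀}_M(K̄^H)`:
at `v ≠ 𝔮` the inertia groups `H ⊓ I_v = S ⊓ I_v` agree and the local condition transfers back (`resOfLe_injective_of_ge`), exactly as in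
bsd-eis `IwasawaTwoVariable.mem_datumSelmer_of_resOfLe_mem`; at `𝔮` it is the input. [cite: GreenbergVatsal2000, §2 pp. 17, 20] -/
theorem mem_datumSelmer_of_resOfLe_mem_of_at (hSH : S ≤ H) {𝔮 : HeightOneSpectrum (𝓞 K)} (h𝔮 : ((p : ℕ) : 𝓞 K) ∈ 𝔮.asIdeal)
    (hI : ∀ v : HeightOneSpectrum (𝓞 K), v ≠ 𝔮 → H ⊓ inertia v ≤ S) {c : subgroupH1 H M}
    (hat : ∀ σ : absoluteGaloisGroup K, conjH1 H M σ c ∈ (L 𝔮 h𝔮).greenbergKer H)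
    (hc : resOfLe M hSH c ∈ datumSelmer S M p L S₀) : c ∈ datumSelmer H M p L S₀ := by
  rw [mem_datumSelmer_iff, mem_unramifiedOutside_iff] at hc ⊢
  refine ⟨fun v hv hpv σ ↦ ?_, fun v hv σ ↦ ?_⟩
  · have hne : v ≠ 𝔮 := fun h ↦ hpv (h ▸ h𝔮)
    have h := hc.1 v hv hpv σ
    rw [← resOfLe_conjH1_comm hSH] at h
    have h' : resH1Hom (inertiaInToH S v) (AddMonoidHom.id M) (id_smul_inertiaInToH S v)
        (resOfLe M hSH (conjH1 H M σ c)) = 0 := h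
    rw [resH1Hom_inertiaIn_resOfLe_id] at h'
    have hinj : Function.Injective
        (Literature.NumberTheory.EllipticCurves.resOfLe M (inertiaIn_mono hSH v)) :=
      resOfLe_injective_of_ge M (inertiaIn_mono hSH v) (inertiaIn_le_of_inf_inertia_le v (hI v hne))
    exact (injective_iff_map_eq_zero _).1 hinj _ h'
  · by_cases hne : v = 𝔮
    · subst hne
      exact hat σ
    · have h := hc.2 v hv σ
      rw [← resOfLe_conjH1_comm hSH, LocalDatum.mem_greenbergKer_iff, greenbergMap_resOfLe] at h
      have hinj : Function.Injective
          (Literature.NumberTheory.EllipticCurves.resOfLe (L v hv).Gr (inertiaIn_mono hSH v)) :=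
        resOfLe_injective_of_ge _ (inertiaIn_mono hSH v) (inertiaIn_le_of_inf_inertia_le v (hI v hne))
      exact (injective_iff_map_eq_zero _).1 hinj _ h

end Generic

/-! ## §2 The `ℤ_p²`-tower with the partner unramified outside `𝔮`: the image of slot-1 control is cut out at `𝔮` alone -/

section Pair

variable {K : Type u} [Field K] [NumberField K] {p : ℕ} [Fact p.Prime] {κ κ₂ : ZpExtension K p}
  {M : Type u} [AddCommGroup M] [DistribMulAction (absoluteGaloisGroup K) M] [TopologicalSpace M] [DiscreteTopology M]
  {𝔮 : HeightOneSpectrum (𝓞 K)}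

/-- If the PARTNER `κ₂` is unramified outside `𝔮`, then `ker κ ⊓ I_w ≤ pairKer κ κ₂` at every `w ≠ 𝔮`: `K̃_∞ / K_∞` (with `K_∞ = K̄^{ker κ}`)
is unramified away from `𝔮`. (At `𝔮` itself this FAILS when `κ₂` ramifies there — M-LINE-PIN's `v̄`.) [cite: Agboola2007, §1 p. 1] -/
theorem kerSubgroup_inf_inertia_le_pairKer_of_ne (hκ₂ : κ₂.IsUnramifiedOutside 𝔮) {w : HeightOneSpectrum (𝓞 K)} (hw : w ≠ 𝔮) :
    κ.kerSubgroup ⊓ inertia w ≤ ZpExtension.pairKer κ κ₂ := by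
  intro x hx
  rw [ZpExtension.mem_pairKer_iff]
  exact ⟨ZpExtension.mem_kerSubgroup.mp hx.1, ZpExtension.mem_kerSubgroup.mp (hκ₂ w hw hx.2)⟩

variable {g : unrSelmer κ M 𝔮 ∅ →+ unrSelmer₂ κ κ₂ M 𝔮}
  (hg : ∀ t : unrSelmer κ M 𝔮 ∅,
    ((g t : unrSelmer₂ κ κ₂ M 𝔮) : subgroupH1 (ZpExtension.pairKer κ κ₂) M) =
      resOfLe M (ZpExtension.pairKer_le_left κ κ₂) (t : subgroupH1 κ.kerSubgroup M))
include hg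

/-- **THE IMAGE OF SLOT-1 CONTROL IS CUT OUT AT `𝔮` ALONE.** For the control map `g : H¹_nr(K_∞, M) → H¹_nr(K̃_∞, M)` of (C1) (`K_∞` the
first slot's line, datum `bdpData M p 𝔮`, `S₀ = ∅`) and a partner `κ₂` unramified outside `𝔮 ∣ p`: a class `s ∈ H¹_nr(K̃_∞, M)` lies in
`im g` IFF it has a lift `y ∈ H¹(K_∞, M)` (`res y = s`) all of whose conjugates satisfy the datum's Greenberg condition AT `𝔮` — the
conditions at every other place transfer from `s` (§1). Hence the cokernel of control onto the liftable classes is exactly the failure of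
the `𝔮`-condition on lifts: the `v̄`-defect of M-LINE-PIN, nothing else. [cite: GreenbergVatsal2000, §2 pp. 17–21] [cite: GreenbergLNM1716, §3 Lemma 3.2] -/
theorem mem_range_lineRes_unr_iff_exists_lift (hκ₂ : κ₂.IsUnramifiedOutside 𝔮) (h𝔮 : ((p : ℕ) : 𝓞 K) ∈ 𝔮.asIdeal)
    (s : unrSelmer₂ κ κ₂ M 𝔮) :
    s ∈ g.range ↔ ∃ y : subgroupH1 κ.kerSubgroup M,
      resOfLe M (ZpExtension.pairKer_le_left κ κ₂) y = (s : subgroupH1 (ZpExtension.pairKer κ κ₂) M) ∧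
      ∀ σ : absoluteGaloisGroup K, conjH1 κ.kerSubgroup M σ y ∈
        ((Castella2018.AcSelmer.bdpData M p 𝔮) 𝔮 h𝔮).greenbergKer κ.kerSubgroup := by
  constructor
  · rintro ⟨t, rfl⟩
    refine ⟨(t : subgroupH1 κ.kerSubgroup M), (hg t).symm, fun σ ↦ ?_⟩
    exact ((mem_datumSelmer_iff (t : subgroupH1 κ.kerSubgroup M)).mp t.2).2 𝔮 h𝔮 σ
  · rintro ⟨y, hy, hat⟩
    have hymem : y ∈ unrSelmer κ M 𝔮 ∅ := by
      refine mem_datumSelmer_of_resOfLe_mem_of_at (Castella2018.AcSelmer.bdpData M p 𝔮) ∅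
        (ZpExtension.pairKer_le_left κ κ₂) h𝔮 (fun v hv ↦ kerSubgroup_inf_inertia_le_pairKer_of_ne hκ₂ hv) hat ?_
      rw [hy]
      exact s.2
    exact ⟨⟨y, hymem⟩, Subtype.ext (by rw [hg]; exact hy)⟩

/-- **Contrapositive: a class OUTSIDE the image has NO lift satisfying the `𝔮`-condition** — every lift of it to `H¹(K_∞, M)` is ramified
(fails the datum's Greenberg condition) at some conjugate of `𝔮`. Combined with (C1)'s defect criterion
(`exists_mem_ker_transpose_unr_of_not_mem_range`), this is where and only where `ker φ` exceeds `T₂ • D₂.X`.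
[cite: GreenbergLNM1716, §3 Lemma 3.2] -/
theorem forall_lift_not_forall_greenbergKer_of_not_mem_range (hκ₂ : κ₂.IsUnramifiedOutside 𝔮) (h𝔮 : ((p : ℕ) : 𝓞 K) ∈ 𝔮.asIdeal)
    {s : unrSelmer₂ κ κ₂ M 𝔮} (hs : s ∉ g.range) (y : subgroupH1 κ.kerSubgroup M)
    (hy : resOfLe M (ZpExtension.pairKer_le_left κ κ₂) y = (s : subgroupH1 (ZpExtension.pairKer κ κ₂) M)) :
    ∃ σ : absoluteGaloisGroup K, conjH1 κ.kerSubgroup M σ y ∉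
      ((Castella2018.AcSelmer.bdpData M p 𝔮) 𝔮 h𝔮).greenbergKer κ.kerSubgroup := by
  by_contra h
  push Not at h
  exact hs ((mem_range_lineRes_unr_iff_exists_lift hg hκ₂ h𝔮 s).mpr ⟨y, hy, h⟩)

end Pair

end Summit.BirchSwinnertonDyer.BirchSwinnertonDyer.Theorems.PrintCf2.LinePinControl

end
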